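import Summits.CriticalPhenomena.PercolationContinuityZ3.Theorems.Transplant.SkelPhiFaceKitsGFC
import Summits.CriticalPhenomena.PercolationContinuityZ3.Theorems.Transplant.SkelPhiForcedFaceKitClauseCQ
import Summits.CriticalPhenomena.PercolationContinuityZ3.Theorems.Transplant.SkelPhiForcedColumnPlaceQ
import Summits.CriticalPhenomena.PercolationContinuityZ3.Theorems.Transplant.TwoAxisParaCellsFineFrameQ
import HarnessLib
/-!
# WAVE-Q binder row «SkelPhiFaceKitsGFC» ↦ «SkelPhiFaceKitsGFCQ» (quasi-step rung (N3-b); captain gen-1 g4, WAVE-Q-BINDER-rows v0.7/v0.8, row Q40, FLOOR row; family stmt-g33 = «SkelPhiCorridor*» / «SkelPhiFace*»):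
# **THE FACE KITS FROM A ROUTE AT EVERY CENTRE (face frame window) AND THE FACE-STEP NEIGHBOURHOOD FEEDER, UNDER EXACT-FOOTPRINT QUASI-STEPS** — `FinePrm.hkits_face_of_routeFCQ`,
# `Skelφ.hkits_faceStepWNbFCQ`

builds on p205010 (kernel theorem, internal audit signed; external expert review pending) — nothing in this file uses p205010; nothing here is a claim about any open node (the
quasi-step node's statement, name and wording are a lead's).  Lane `prim-bschramm`, seat `prim-bschramm-stmt` gen 33 (port pen).  Helper file (`--supports stmt-CriticalPhenomena-4575 --as helper`);
def-free.  PORT RULES (captain #6109/#6122 hunk classes + R-1 = L-hp8-1 (b)): twins of the two `hstep`-threading declarations of the tree module «SkelPhiFaceKitsGFC» (sha256 3ba343566063d0e3…,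
imported), statements and proofs BYTE-IDENTICAL except: (i) `(hstep : Steps G φ) ↦ {M : ℕ} (hqφ : Skelφ.QStepsN G φ M)` (named `Mq` in `hkits_faceStepWNbFCQ`, whose window
half-width is already called `M`), with the FACE-FRAME cost floor `hPN : 3 ≤ P.N ↦ 3·M ≤ P.N` (the face frame of a cost-`M` chart has quasi-steps of cost `3M` — gen-1 g4's
`FinePrm.qStepsN_frame_q`, «TwoAxisParaCellsFineFrameQ»; the window map is `(qStepsN_frame_q hqφ …).mono hPN`, the callee's `QStepsN G φ P.N` is `hqφ.mono (M ≤ P.N)`);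
(ii) `kitClause_frameFC ↦ kitClause_frameFC_q` («SkelPhiForcedFaceKitClauseCQ» Q32, hp-8 g62), `ctColEnd ↦ ctColEndQ`, `ψ_ctColEnd_mem_Icc / ctColEnd_reach ↦ …_q` (Q06/Q07),
`hkits_face_of_routeFC ↦ …Q`; (iv) FLOOR tokens (p5-g28's pull list): `KCmax ↦ P.N·KCmax` in `hDw`, `hT'`, `hr₀`, `hrs`, `hE`, `hreach`, `hMD` (`shellD + 1 + d + PA.N·KCmax + Rs ≤ 2M + 2`),
`KCmax + 1 ↦ (KCmax+1)·(P.N+2)` in `hcS`.  Regression: `M = 1`, `P.N`-tokens at `qStepsN_of_steps` give the original.  Docstrings and citations are the original's.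
-/

noncomputable section

open scoped Classical

namespace Summit.CriticalPhenomena.PercolationContinuityZ3.Theorems.Transplant

namespace Skelφ

open MeasureTheory
open Literature.Probability.Percolation Literature.Probability.LatticeModels SimpleGraph KNLevels GadgetSystem Contour
open Literature.Barriers.CriticalPhenomena (graphBall graphBall_finite mem_graphBall_self graphBall_mono)
open Skel (winGraph winGraph_adj winGraph_le KitGeom WinStepData)
open SkelI (tanOff tanTgt tanTgt_mem)
open Literature.Probability.Percolation.KozmaNitzan.Cells (oth oth_ne eq_oth_of_ne oth_oth)
open BoxProdZ2 (ConcRadiiG)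

variable {V : Type} [DecidableEq V] {G : SimpleGraph V} [G.LocallyFinite] {φ : V → Site 2}

namespace FinePrm

/-- **THE FORCED KIT CLAUSE OF A FACE-FRAME LEVEL FROM A ROUTE AT EVERY NEAR CENTRE** (`hkits` of `kitsAt_stepAFF` / of `faceOblRM_fineNb`'s
F-twin at one level `j` of the face step; the (S0) twin of `hkits_face_of_routeG`/`hkits_face_of_route`): the window is hp-8's face frame
`pr.frame φ t I b` about `w₀` (radius `R`), the level box `[lo − j, hi + j]`, the region `D ⊇` the level window, the target `T` holds the far part of
the level; the zone datum `Λc c kz` at the kit centres (inside `Rg c`, connected, `c ∈ Λc c kz`, containing the fat-prism box `cylBallFin c kz Rk`);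
and at every centre in the `E`-enlarged box within `B(w₀, R − r)` a ROUTE `∃ Qt Ft, Ft ⊆ T ∧ Qt ⊆ D ∧ 1 − δ³ ≤ P_{Wt}(linkIn Qt (Λc c kz) Ft)`.
No zone estimate, no exit pieces ((S0): the kit's own seed box is forced — p1-g16's `kitClause_frameFC`).
[cite: KozmaNitzan2024, §4 Lemma 10 (pp. 17–21)] [cite: MartineauTassion2017, §4.3 Lemma 4.2] [this work] -/
theorem hkits_face_of_routeFCQ [Countable V] (hlipφ : Lip G φ) {M : ℕ} (hqφ : QStepsN G φ M)
 {Δ : ℕ} (hΔ : ∀ v, G.degree v ≤ Δ) {q : unitInterval} {δ : ℝ} (hδ : 0 < δ)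
    -- the face frame
    (pr : FinePrm) (t : V) (I b : Fin 2) (hD : 0 < pr.D) (hL0 : pr.c₀ * pr.L 0 ≤ pr.D)
    (hL1 : pr.c₁ * pr.L 1 ≤ pr.D) (hc : 0 < pr.cOf I) (hA0 : 0 < pr.A) (hb : |pr.lvGen I (oth b)| ≤ |pr.lvGen I b|)
    (hnz : pr.lvGen I b ≠ 0) {nF : ℕ} (hnC : (nF : ℤ) ≤ pr.cOf I * |pr.A| * |pr.lvGen I b|) (hU3 : pr.D ≤ 3 * (nF : ℤ))
    -- the level box and the window
    {lo hi : Site 2} {j : ℕ} {w₀ : V} {R r : ℕ}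
    -- kit constants
    (P : ApronPrm) {nz Rs KCmax rs cS cU E : ℕ} (hPN : 3 * M ≤ P.N) (hA : P.A = (nz + 1 : ℕ) * pr.D + 1)
    (hdD : P.d + 2 ≤ shellD P) (hDρ : Rs + 1 ≤ shellD P) (hKCmax : (shellD P + nz + 1) * 3 ≤ KCmax)
    (hwide : ∀ i, (lo - (j : Site 2)) i + 2 * tanOff P.ℓs P.M ≤ (hi + (j : Site 2)) i)
    (hdw : ∀ i, (lo - (j : Site 2)) i + (P.d + 2 : ℕ) ≤ (hi + (j : Site 2)) i)
    (hDw : ∀ i, (lo - (j : Site 2)) i + ((shellD P + 1 + P.d + P.N * KCmax + Rs : ℕ) : ℤ) ≤ (hi + (j : Site 2)) i)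
    (hT' : (shellD P : ℤ) + P.N * KCmax + Rs ≤ tanOff P.ℓs P.M)
    (hr₀ : P.N * (tanOff P.ℓs P.M + 2) + P.N * P.d + (P.N * KCmax + Rs) ≤ P.r₀) (hR : P.r₀ ≤ R)
    (hrs : 1 + (P.N * (tanOff P.ℓs P.M + 2) + P.N * P.d + (P.N * KCmax + Rs)) ≤ rs)
    (hcS : (P.N + 1) * (tanOff P.ℓs P.M + 1) + (P.N + 1) * P.d + (KCmax + 1) * (P.N + 2) + cU ≤ cS)
    -- the reach of the kit centre: inside the `E`-enlargement, and `B(w₀, R − r)`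
    (hE : j + (P.N * (tanOff P.ℓs P.M + 1) + P.N * P.d + P.N * KCmax) ≤ E) (hreach : r + (P.N * (tanOff P.ℓs P.M + 1) + P.N * P.d + P.N * KCmax) ≤ P.r₀)
    -- the short region and the zone datum at the kit centres (inside `Rg`, connected from the centre inside itself, containing the centre and the
    -- fat-prism zone box of record `cylBallFin c kz Rk`, `Rk ≥ cylRadMax types kz (2·KCmax)`)
    (Rg : V → Finset V) (hRg : ∀ c, ∀ u ∈ Rg c, u ∈ graphBall G c Rs) (hRgcard : ∀ c, (Rg c).card ≤ cU) (hcU1 : 1 ≤ cU)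
    (Λc : V → ℕ → Finset V) (kz : ℕ) (hΛRg : ∀ c, Λc c kz ⊆ Rg c) (hzconn : ∀ c, ∀ s ∈ Λc c kz, PathIn G (↑(Λc c kz) : Set V) c s)
    (hcz : ∀ c, c ∈ Λc c kz)

    -- the level's source/support, the weighting on the region, the target
    (kk : ℕ) (o : V) (Sfin : Finset V) {Wt : Sym2 V → unitInterval} {D T : Finset V}
    (hXD : winLevel G (pr.frame φ t I b) w₀ R lo hi j ⊆ D)
    (hfarT : ∀ v ∈ winLevel G (pr.frame φ t I b) w₀ R lo hi j, v ∉ graphBall G w₀ (R - P.r₀) → v ∈ T)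
    {N : ℕ} (hN : kk * (Δ + 1) ^ (2 * rs) ≤ N) (hk : (1 - (q : ℝ) ^ (1 + Δ * cS + cS * cU)) ^ kk ≤ δ)
    -- THE ROUTE at every centre of the enlarged box near the window centre, at accuracy `δ³` (no zone / exit estimates: (S0))
    (hroute : ∀ c, pr.frame φ t I b c ∈ Finset.Icc (lo - ((E : ℕ) : Site 2)) (hi + ((E : ℕ) : Site 2)) → c ∈ graphBall G w₀ (R - r) →
      ∃ Qt Ft : Finset V, Ft ⊆ T ∧ Qt ⊆ D ∧ 1 - δ ^ 3 ≤ (prodBernoulli Wt).real (linkIn (↑Qt : Set V) (Λc c kz) Ft)) :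
    ∃ (σ' : SData V) (S : Finset V), SHyp (winLData G (pr.frame φ t I b) w₀ R lo hi o Sfin) j σ' ∧ σ'.N ≤ N ∧
      (1 - (q : ℝ) ^ σ'.sB) ^ σ'.k ≤ δ ∧ S ⊆ D ∧ (∀ x ∈ σ'.K, σ'.face x ⊆ S) ∧
      RelayClause (winLData G (pr.frame φ t I b) w₀ R lo hi o Sfin) Wt j σ' S T D δ := by
  set ψ := pr.frame φ t I b with hψ
  set SF := pr.sideFormsU_frame φ t I b hc hA0.ne' hnz hD (lo - (j : Site 2)) (hi + (j : Site 2)) with hSF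
  have hKeq : winLevel G ψ w₀ R lo hi j = Win G ψ w₀ (Finset.Icc (lo - (j : Site 2)) (hi + (j : Site 2))) R := rfl
  have hLI : pr.cOf I * pr.L I ≤ pr.D := pr.cOf_mul_L_le hL0 hL1 I
  -- the frame facts used for the reach
  have hlip : Lip G ψ := pr.lip_frame hlipφ t I b hc.le hD hLI
  have hU3' : pr.D ≤ 3 * (pr.cOf I * |pr.A| * |pr.lvGen I b|) := hU3.trans (by linarith only [hnC])
  have hq : QStepsN G ψ P.N := (pr.qStepsN_frame_q hqφ t I b hc hA0.ne' hD hLI hb hnz hU3').mono hPN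
  have hMN : M ≤ P.N := by omega
  have hU1 : (1 : ℤ) ≤ pr.D := hD
  have hnF1 : 1 ≤ nF := by
    have h3 : (0 : ℤ) < 3 * (nF : ℤ) := lt_of_lt_of_le hD hU3
    omega
  have hnD : (nF : ℤ) ≤ pr.D := hnC.trans ((pr.cOf_abs_lvGen_le I b hc.le).trans hLI)
  have hU : pr.D ≤ ((2 + 1 : ℕ) : ℤ) * nF := by
    have e' : ((2 + 1 : ℕ) : ℤ) * nF = 3 * (nF : ℤ) := by push_cast; ring
    rw [e']; exact hU3
  have haff : ∀ (i : Fin 2) (σ₀ : ℤˣ), (SF i σ₀).IsAffine pr.D (pr.climC I b i) := fun i σ₀ => by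
    rw [hSF]; exact pr.sideFormsU_frame_isAffine φ t I b hc hA0.ne' hnz hD hLI _ _ i σ₀
  have hC : ∀ (i : Fin 2) (σ₀ : ℤˣ), (nF : ℤ) ≤ pr.climC I b i := fun i σ₀ => by
    unfold FinePrm.climC; split_ifs
    · exact hnC
    · exact hnD
  have hKCmax' : (shellD P + nz + 1) * (2 + 1) ≤ KCmax := hKCmax
  have hKC := hKC_of_affine SF haff hU1 P hnF1 hC hU hA hKCmax'
  refine kitClause_frameFC_q hlipφ hqφ hΔ hδ pr t I b hD hL0 hL1 hc hA0.ne' hb hnz hnC hU3 P hPN hA hdD hDρ hKCmax hwide hdw hDw hT' hr₀ hR hrs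
    hcS Rg hRg hRgcard hcU1 Λc kz hΛRg hzconn hcz kk o Sfin hXD hN hk (fun x hx hfar => ?_) (fun x hx hnear => ?_)
  · -- FAR: the inner neighbour lies in the level and outside `B(w₀, R − r₀)`
    refine hfarT _ ?_ hfar
    have h := inNbr_spec (G := G) (φ := ψ) (by rw [hKeq] at hx; exact hx)
    rw [hKeq]
    exact (mem_Win G ψ).2 ⟨h.2.1, h.2.2⟩
  · -- NEAR: the route at the kit centre (the zone-box disjunction's second branch)
    refine Or.inr ?_
    have hx' : x ∈ outerBoundary (winGraph G w₀ R) (Win G ψ w₀ (Finset.Icc (lo - (j : Site 2)) (hi + (j : Site 2))) R) := by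
      rw [hKeq] at hx; exact hx
    set c := ctColEndQ G SF P w₀ R x with hcdef
    have hcI : ψ c ∈ Finset.Icc (lo - ((E : ℕ) : Site 2)) (hi + ((E : ℕ) : Site 2)) :=
      ψ_ctColEnd_mem_Icc_q SF hlip hq (hqφ.mono hMN) hwide (fun i σ₀ z h1 _ => hKC i σ₀ z h1) hE hx
    have hcw : c ∈ graphBall G w₀ (R - r) := by
      have hd := ctColEnd_reach_q SF hlip hq (hqφ.mono hMN) hwide (fun i σ₀ z h1 _ => hKC i σ₀ z h1) hx'
      have h := BoxProdZ2.mem_graphBall_add G hnear hd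
      exact graphBall_mono G _ (by omega) h
    exact hroute c hcI hcw

end FinePrm

/-- **THE FORCED KIT CLAUSE OF LEVEL `j′ ∈ [M+1, Rlev]` OF THE FACE STEP `faceStepWNb`** (the `hkits` hypothesis of `faceOblRM_fineNb`'s
F-twin at one level; the (S0) twin of `hkits_faceStepWNbG`), from the zone datum rows and a route at accuracy `δ³` at every centre of the
`E`-enlarged level box inside `B(w₀, rE − r)`. [cite: KozmaNitzan2024, §4 Lemma 10 (pp. 17–21), p. 30 (Step III)] [cite: MartineauTassion2017, §4.3 Lemma 4.2] -/
theorem hkits_faceStepWNbFCQ [Countable V] (hlipφ : Lip G φ) {Mq : ℕ} (hqφ : QStepsN G φ Mq)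
 {Δ : ℕ} (hΔ : ∀ v, G.degree v ≤ Δ) {q : unitInterval} {δ : ℝ} (hδ : 0 < δ)
    -- the face frame at the window centre
    (pr : FinePrm) (w₀ : V) (du : MDir) (b : Fin 2) (hc₀ : 0 < pr.c₀) (hc₁ : 0 < pr.c₁) (hD : 0 < pr.D) (hL0 : pr.c₀ * pr.L 0 ≤ pr.D)
    (hL1 : pr.c₁ * pr.L 1 ≤ pr.D) (hA0 : 0 < pr.A) (hb : |pr.lvGen du.1 (oth b)| ≤ |pr.lvGen du.1 b|)
    (hnz : pr.lvGen du.1 b ≠ 0) {nF : ℕ} (hnC : (nF : ℤ) ≤ pr.cOf du.1 * |pr.A| * |pr.lvGen du.1 b|) (hU3 : pr.D ≤ 3 * (nF : ℤ))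
    -- the face step
    (P : PCells2) (Λ : ConcRadiiG) (b₀ : Fin 2 → ℕ) (a' : ℕ) (x : Site 2) (j : ℕ) (pc : ℤ) (aw Rlev N M L' : ℕ) (Sfin : Finset V)
    {yF : V} (hyF : pr.ψ φ w₀ yF = P.faceCen x du j) (hpc : pc = relφ φ w₀ yF b) (hjK : j + 1 ≤ P.K) (hRlev : Rlev + 4 ≤ 10 * P.s du.1)
    (hRlev' : Rlev + 4 ≤ 3 * P.r (oth du.1)) {kF : ℤ}
    (hroomF : pr.Mabs * (aw + Rlev + 1) + pr.rdN du.1 b * (Rlev + 2) * pr.D ≤ pr.rdK du.1 b * kF * pr.D) (hkF : kF + 3 ≤ 5 * P.r (oth du.1))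
    {j' : ℕ} (hj'M : M + 1 ≤ j') (hj'R : j' ≤ Rlev)
    -- kit constants
    (PA : ApronPrm) {nz Rs KCmax rs cS cU E r : ℕ} (hPN : 3 * Mq ≤ PA.N) (hA : PA.A = (nz + 1 : ℕ) * pr.D + 1)
    (hdD : PA.d + 2 ≤ shellD PA) (hDρ : Rs + 1 ≤ shellD PA) (hKCmax : (shellD PA + nz + 1) * 3 ≤ KCmax)
    (hMtan : tanOff PA.ℓs PA.M ≤ (M : ℤ) + 1) (hMd : PA.d + 2 ≤ 2 * M + 2) (hMD : shellD PA + 1 + PA.d + PA.N * KCmax + Rs ≤ 2 * M + 2)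
    (hT' : (shellD PA : ℤ) + PA.N * KCmax + Rs ≤ tanOff PA.ℓs PA.M)
    (hr₀ : PA.N * (tanOff PA.ℓs PA.M + 2) + PA.N * PA.d + (PA.N * KCmax + Rs) ≤ PA.r₀) (hR : PA.r₀ ≤ Λ.rE a' x du)
    (hrs : 1 + (PA.N * (tanOff PA.ℓs PA.M + 2) + PA.N * PA.d + (PA.N * KCmax + Rs)) ≤ rs)
    (hcS : (PA.N + 1) * (tanOff PA.ℓs PA.M + 1) + (PA.N + 1) * PA.d + (KCmax + 1) * (PA.N + 2) + cU ≤ cS)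
    (hE : Rlev + (PA.N * (tanOff PA.ℓs PA.M + 1) + PA.N * PA.d + PA.N * KCmax) ≤ E)
    (hreach : r + (PA.N * (tanOff PA.ℓs PA.M + 1) + PA.N * PA.d + PA.N * KCmax) ≤ PA.r₀)
    (hrim : Λ.rM a' (x + stepVec du) - L' + PA.r₀ ≤ Λ.rE a' x du)
    -- the short region and the zone datum at the kit centres (inside `Rg`, connected, containing the centre and the fat-prism box `cylBallFin c kz Rk`)
    (Rg : V → Finset V) (hRg : ∀ c, ∀ u ∈ Rg c, u ∈ graphBall G c Rs) (hRgcard : ∀ c, (Rg c).card ≤ cU) (hcU1 : 1 ≤ cU)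
    (Λc : V → ℕ → Finset V) (kz : ℕ) (hΛRg : ∀ c, Λc c kz ⊆ Rg c) (hzconn : ∀ c, ∀ s ∈ Λc c kz, PathIn G (↑(Λc c kz) : Set V) c s)
    (hcz : ∀ c, c ∈ Λc c kz)

    (kk : ℕ) {Wt : Sym2 V → unitInterval}
    (hN : kk * (Δ + 1) ^ (2 * rs) ≤ N) (hk : (1 - (q : ℝ) ^ (1 + Δ * cS + cS * cU)) ^ kk ≤ δ)
    -- THE ROUTE at every centre of the enlarged box near the window centre, at accuracy `δ³`
    (hroute : ∀ c, pr.frame φ w₀ du.1 b c ∈ Finset.Icc (loN P x du j pc aw - ((E : ℕ) : Site 2)) (hiN P x du j pc aw + ((E : ℕ) : Site 2)) →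
      c ∈ graphBall G w₀ (Λ.rE a' x du - r) →
      ∃ Qt Ft : Finset V, Ft ⊆ (faceStepWNb G pr φ P w₀ Λ b₀ b a' x du j pc aw Rlev N M L' Sfin).T ∧
        Qt ⊆ stepRg G (pr.frame φ w₀ du.1 b) (faceStepWNb G pr φ P w₀ Λ b₀ b a' x du j pc aw Rlev N M L' Sfin) ∧
        1 - δ ^ 3 ≤ (prodBernoulli Wt).real (linkIn (↑Qt : Set V) (Λc c kz) Ft)) :
    let Q := faceStepWNb G pr φ P w₀ Λ b₀ b a' x du j pc aw Rlev N M L' Sfin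
    ∃ (σ : KNLevels.SData V) (Sz : Finset V),
      KNLevels.SHyp (winLData G (pr.frame φ w₀ du.1 b) Q.root Q.Rπ Q.lo Q.hi Q.root Q.Sfin) j' σ ∧ σ.N ≤ Q.N ∧
      (1 - (q : ℝ) ^ σ.sB) ^ σ.k ≤ δ ∧ Sz ⊆ stepRg G (pr.frame φ w₀ du.1 b) Q ∧ (∀ x' ∈ σ.K, σ.face x' ⊆ Sz) ∧
      KNLevels.RelayClause (winLData G (pr.frame φ w₀ du.1 b) Q.root Q.Rπ Q.lo Q.hi Q.root Q.Sfin) Wt j' σ Sz Q.T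
        (stepRg G (pr.frame φ w₀ du.1 b) Q) δ := by
  intro Q
  -- the wide level box
  have hw := loN_hiN_hwide P x du j pc aw hj'M
  have hwide : ∀ i, (loN P x du j pc aw - (j' : Site 2)) i + 2 * tanOff PA.ℓs PA.M ≤ (hiN P x du j pc aw + (j' : Site 2)) i := fun i => by
    have := hw i; linarith
  have hMd' : ((PA.d + 2 : ℕ) : ℤ) ≤ 2 * M + 2 := by exact_mod_cast hMd
  have hMD' : ((shellD PA + 1 + PA.d + PA.N * KCmax + Rs : ℕ) : ℤ) ≤ 2 * M + 2 := by exact_mod_cast hMD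
  have hdw : ∀ i, (loN P x du j pc aw - (j' : Site 2)) i + (PA.d + 2 : ℕ) ≤ (hiN P x du j pc aw + (j' : Site 2)) i := fun i => by
    have := hw i; linarith
  have hDw : ∀ i, (loN P x du j pc aw - (j' : Site 2)) i + ((shellD PA + 1 + PA.d + PA.N * KCmax + Rs : ℕ) : ℤ) ≤ (hiN P x du j pc aw + (j' : Site 2)) i :=
    fun i => by have := hw i; linarith
  -- the level inside the region; the far part inside the rim
  have hXD : winLevel G (pr.frame φ w₀ du.1 b) w₀ (Λ.rE a' x du) (loN P x du j pc aw) (hiN P x du j pc aw) j' ⊆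
      stepRg G (pr.frame φ w₀ du.1 b) Q :=
    winLevel_subset_stepRg_faceStepWNb G φ P w₀ Λ b₀ a' N M L' Sfin hyF hpc hjK hRlev hRlev' hc₀ hc₁ hD hnz hroomF hkF (by omega)
  have hfarT : ∀ v ∈ winLevel G (pr.frame φ w₀ du.1 b) w₀ (Λ.rE a' x du) (loN P x du j pc aw) (hiN P x du j pc aw) j',
      v ∉ graphBall G w₀ (Λ.rE a' x du - PA.r₀) → v ∈ Q.T := fun v hv hfar =>
    far_mem_faceStepWNb_T G φ pr P w₀ Λ b₀ b a' x du j pc aw Rlev N M L' Sfin hrim (hXD hv) hfar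
  have hE' : j' + (PA.N * (tanOff PA.ℓs PA.M + 1) + PA.N * PA.d + PA.N * KCmax) ≤ E := le_trans (by omega) hE
  exact FinePrm.hkits_face_of_routeFCQ hlipφ hqφ hΔ hδ pr w₀ du.1 b hD hL0 hL1 (pr.cOf_pos hc₀ hc₁ du.1) hA0 hb hnz hnC hU3
    PA hPN hA hdD hDρ hKCmax hwide hdw hDw hT' hr₀ hR hrs hcS hE' hreach Rg hRg hRgcard hcU1 Λc kz hΛRg hzconn hcz
    kk w₀ Sfin hXD hfarT hN hk hroute

end Skelφ

end Summit.CriticalPhenomena.PercolationContinuityZ3.Theorems.Transplant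

end
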